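import Mathlib
import Literature.AlgebraicGeometry.Resolution.ArithmeticalThreefolds
import Literature.RingTheory.KrullDimension.AffineDimension
import Literature.AlgebraicGeometry.Resolution.LocalBlowup
import Literature.AlgebraicGeometry.Resolution.AffineDomainEquidim
import Literature.AlgebraicGeometry.Resolution.ExcellentRingsFieldProofs
import Literature.AlgebraicGeometry.Resolution.ExcellentRingsEssFiniteType
import Literature.RingTheory.KrullDimension.LocalizationDimension
import Literature.AlgebraicGeometry.Resolution.MonomializationAlongValuation
import HarnessLib

/-!
# Lens 5 (g9) — §2 INPUT 1 of THEOREM T made concrete: the regular model of the TWIST FIELD `M⁺ = k·K^p(g₀)` from F-02 (`.lu3`)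

Crux workfile on stmt-ResolutionOfSingularities-0549 (`DescentPerfectToAll`), lineage res-B-lens-5, generation g9.
bears_on: LADDER-RESOLUTION:B · [OURS · CANDIDATE] counted 0; nothing here proves resolution in char p; resolution in char p NOT proved.
Port-ready (copy verbatim; the `Cruxes` tree is not built on the farm); imports only Mathlib + two BUILT Literature modules; def-free.

This is the plumbing announced in CONFIRM bus l.85589 (shape (b)): how the solved sibling F-02 = `CossartPiltant2019` — consumed as
`(h02 : CossartPiltant2019).lu3 k : LocalUniformization3 k` (`Literature/…/ArithmeticalThreefolds.lean` :191, `ResolutionLU.lean` :446) — is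
applied to a SUBFIELD of `K` of finite type over `k`, in particular to the twist field `M⁺ := k(a₁^p, …, a_r^p, g₀) = k·K^p(g₀)` of
memo `CLASSBC-prank2-toric-lens5-g9.md` §2.

* `mem_adjoin_preimage_iff` — for `S ⊆ K` and `M := IntermediateField.adjoin k S`: the `k`-subalgebra of `↥M` generated by (the pull-back
  of) `S` is `k[S]` (membership computed in `K`).
* `exists_regular_model_subfield` — **the M-side model.**  `LocalUniformization3 k`, an affine model `A ⊆ O` of `K` (`A.FG`, `Frac A = K`,
  `dim A ≤ 3`) and a finite `S ⊆ O` give a finitely generated `A' ⊆ O ∩ M`, `k[S] ⊆ A'`, of the field `M := k(S)` whose localisation at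
  the centre of `O ∩ M` is a REGULAR local ring.  Obligations discharged here: `k[S] ⊆ O ∩ M`, `k[S].FG`, `Frac k[S] = M`
  (`IsFractionRing.of_field` + `IntermediateField.mem_adjoin_iff_div`), `dim k[S] = trdeg_k k[S] ≤ trdeg_k K = dim A ≤ 3`
  (`Literature.RingTheory.KrullDimension.exists_ringKrullDim_eq_and_trdeg_eq` twice, `trdeg_le_of_injective`, `trdeg_add_eq`).
* `pow_mem_adjoin_image_pow`, `pow_mem_intermediateField_adjoin`, `adjoin_twist_toSubfield_eq`, `adjoin_twist_toSubfield_eq_of_perfectField`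
  — identification of the twist field: with `Algebra.adjoin k t = A`, `Frac A = K` and `t^p ∪ {g₀} ⊆ S`:  every `z^p` (`z ∈ K`) lies in
  `k(S)`, `k(t^p ∪ {g₀})` has underlying subfield `Subfield.closure (range (algebraMap k K) ∪ range (frobenius K p) ∪ {g₀})` (the `M⁺` of
  THEOREM T′), which for PERFECT `k` is `Subfield.closure (range (frobenius K p) ∪ {g₀}) = K^p(g₀)` (the `M` of THEOREM T; cf.
  `Lens5_ImmediateValues.exists_subfield_pthPowers_adjoin`).
* (rev 2) the three SIDE OBLIGATIONS of F-32 (`exists_localRing_monomial_of_embeddedResolution`: `IsExcellentRing R`, `ringKrullDim R = 3`,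
  and the centre being the closed point) for `R := T := A'_{centre}`:  `centreIdeal_isMaximal_of_pow_generators` (closed centre on the
  M-side from the customer's (hzd) on the K-side: `A'[t] ⊆ O` contains `A` and is INTEGRAL over `A'` since `t^p ⊆ A'`; maximality descends,
  `Ideal.isMaximal_comap_of_isIntegral_of_isMaximal`), `isExcellentRing_localization_centre` (tree: `isExcellentRing_of_field` +
  `isExcellentRing_localization_atPrime`), `ringKrullDim_eq_of_adjoin_le` (`dim A' = dim A`: both `trdeg_k K`, `K/k(S)` algebraic as
  `K^p ⊆ k(S)`), assembled in `model_side_obligations` (`… ∧ IsExcellentRing T ∧ ringKrullDim T = 3`, via tree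
  `ringKrullDim_localization_atPrime_eq_of_isMaximal`).  With rev 1 this is ALL of §2's plumbing except the F-32 call itself.
* (rev 3) §2 in the PORT's convention (`locAtCentre`, as THEOREM P's port calls F-32): `centreIdeal_eq_subringCentre` (rfl),
  `valuation_comap_lt_one_iff`, `ringKrullDim_eq_three_of_locAtCentre` (stub's `dim A ≤ 3 ∧ dim A_centre = 3 ⇒ dim A = 3`),
  `subfield_closure_union_inv_eq` + `mem_or_inv_mem_valuationSubring` (`g₀` vs `g₀⁻¹ ∈ O`), `locAtCentre_port_inputs` (R regular, excellent,
  `dim R = 3`, `R ⊆ O`, dominated — every F-32 hypothesis), `exists_twist_model` (customer data + F-02·`.lu3` ⟹ the M-side model with all F-32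
  inputs, one statement), and `monomialise_on_twist_model` — THE F-32 CALL ITSELF on the M-side model under the composite algebra
  `R → ↥M → K` (instance hypotheses), conclusion = F-32's verbatim with `K := ↥M`, `E := K`: §2 is now kernel-complete modulo the two cited
  facts F-02 (`hLU`) and F-32/F-78 (`hEmb`).
-/

set_option linter.dupNamespace false

open Literature.AlgebraicGeometry.Resolution

namespace Summit.ResolutionOfSingularities.ResolutionOfSingularities.Cruxes.DescentPerfectToAll.CpSibling.TwistModel

variable {k : Type} [Field k] {K : Type} [Field K] [Algebra k K]

/-! ## The affine model `k[S]` of the subfield `k(S)` -/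

/-- Membership in the `k`-subalgebra of `↥k(S)` generated by the pull-back of `S` is membership of the underlying element in `k[S] ⊆ K`. -/
theorem mem_adjoin_preimage_iff (S : Set K) (x : IntermediateField.adjoin k S) :
    x ∈ Algebra.adjoin k ((Subtype.val : IntermediateField.adjoin k S → K) ⁻¹' S) ↔ (x : K) ∈ Algebra.adjoin k S := by
  have himg : ((IntermediateField.adjoin k S).val : IntermediateField.adjoin k S → K) ''
      ((Subtype.val : IntermediateField.adjoin k S → K) ⁻¹' S) = S := by
    have : ((IntermediateField.adjoin k S).val : IntermediateField.adjoin k S → K) =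
        (Subtype.val : IntermediateField.adjoin k S → K) := rfl
    rw [this, Set.image_preimage_eq_iff]
    rintro s hs
    exact ⟨⟨s, IntermediateField.subset_adjoin k S hs⟩, rfl⟩
  have hmap : Subalgebra.map (IntermediateField.adjoin k S).val
      (Algebra.adjoin k ((Subtype.val : IntermediateField.adjoin k S → K) ⁻¹' S)) = Algebra.adjoin k S := by
    rw [AlgHom.map_adjoin, himg]
  constructor
  · intro hx
    rw [← hmap]
    exact Subalgebra.mem_map.mpr ⟨x, hx, rfl⟩
  · intro hx
    rw [← hmap] at hx
    obtain ⟨y, hy, hyx⟩ := Subalgebra.mem_map.mp hx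
    have hyx' : y = x := Subtype.ext (by simpa using hyx)
    exact hyx' ▸ hy

/-- `k[S] ⊆ O ∩ k(S)` when `S ⊆ O` and `k ⊆ O`. -/
theorem adjoin_preimage_le_comap (O : ValuationSubring K) (hk : ∀ c : k, algebraMap k K c ∈ O) (S : Set K)
    (hSO : ∀ s ∈ S, s ∈ O) :
    (Algebra.adjoin k ((Subtype.val : IntermediateField.adjoin k S → K) ⁻¹' S)).toSubring ≤
      (O.comap (algebraMap (IntermediateField.adjoin k S) K)).toSubring := by
  intro x hx
  rw [Subalgebra.mem_toSubring] at hx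
  change x ∈ O.comap (algebraMap (IntermediateField.adjoin k S) K)
  rw [ValuationSubring.mem_comap]
  induction hx using Algebra.adjoin_induction with
  | mem x hx => exact hSO _ hx
  | algebraMap r =>
      rw [← IsScalarTower.algebraMap_apply]
      exact hk r
  | add x y _ _ hx hy => rw [map_add]; exact O.add_mem _ _ hx hy
  | mul x y _ _ hx hy => rw [map_mul]; exact O.mul_mem _ _ hx hy

/-- `Frac k[S] = k(S)` (inside `↥k(S)`). -/
theorem isFractionRing_adjoin_preimage (S : Set K) :
    IsFractionRing (Algebra.adjoin k ((Subtype.val : IntermediateField.adjoin k S → K) ⁻¹' S))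
      (IntermediateField.adjoin k S) := by
  refine IsFractionRing.of_field _ _ (fun z => ?_)
  obtain ⟨r, hr, s, hs, hz⟩ := IntermediateField.mem_adjoin_iff_div.mp z.2
  have hrM : r ∈ IntermediateField.adjoin k S := IntermediateField.algebra_adjoin_le_adjoin k S hr
  have hsM : s ∈ IntermediateField.adjoin k S := IntermediateField.algebra_adjoin_le_adjoin k S hs
  refine ⟨⟨⟨r, hrM⟩, (mem_adjoin_preimage_iff S _).mpr hr⟩, ⟨⟨s, hsM⟩, (mem_adjoin_preimage_iff S _).mpr hs⟩, ?_⟩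
  apply Subtype.ext
  simpa using hz

/-- `dim k[S] ≤ dim A` for a finite `S ⊆ K = Frac A`, `A` an affine `k`-domain (both dimensions are transcendence degrees over `k`,
and `trdeg_k k[S] ≤ trdeg_k K = trdeg_k A`). -/
theorem ringKrullDim_adjoin_preimage_le (A : Subalgebra k K) (hfg : A.FG) [IsFractionRing A K] {d : ℕ}
    (hdim : ringKrullDim A ≤ d) (S : Set K) (hSfin : S.Finite) :
    ringKrullDim (Algebra.adjoin k ((Subtype.val : IntermediateField.adjoin k S → K) ⁻¹' S)) ≤ d := by
  have hBfg : (Algebra.adjoin k ((Subtype.val : IntermediateField.adjoin k S → K) ⁻¹' S)).FG := by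
    refine Subalgebra.fg_def.mpr ⟨_, hSfin.preimage Subtype.val_injective.injOn, rfl⟩
  haveI : Algebra.FiniteType k (Algebra.adjoin k ((Subtype.val : IntermediateField.adjoin k S → K) ⁻¹' S)) :=
    (Algebra.adjoin k ((Subtype.val : IntermediateField.adjoin k S → K) ⁻¹' S)).fg_iff_finiteType.mp hBfg
  haveI : Algebra.FiniteType k A := A.fg_iff_finiteType.mp hfg
  obtain ⟨s, hsB, htrB⟩ := Literature.RingTheory.KrullDimension.exists_ringKrullDim_eq_and_trdeg_eq k
    (Algebra.adjoin k ((Subtype.val : IntermediateField.adjoin k S → K) ⁻¹' S))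
  obtain ⟨n, hnA, htrA⟩ := Literature.RingTheory.KrullDimension.exists_ringKrullDim_eq_and_trdeg_eq k A
  haveI : FaithfulSMul k A := (faithfulSMul_iff_algebraMap_injective k A).mpr (algebraMap k A).injective
  haveI : FaithfulSMul A K := (faithfulSMul_iff_algebraMap_injective A K).mpr (IsFractionRing.injective A K)
  haveI : Algebra.IsAlgebraic A K := IsLocalization.isAlgebraic K (nonZeroDivisors A)
  have htrK : Algebra.trdeg k K = (n : Cardinal) := by
    rw [← trdeg_add_eq k A (A := K), trdeg_eq_zero (R := A) (A := K), add_zero, htrA]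
  -- `trdeg_k B ≤ trdeg_k K` along the injective `k`-algebra map `B → M → K`
  have hf : Function.Injective ((IsScalarTower.toAlgHom k (IntermediateField.adjoin k S) K).comp
      (Algebra.adjoin k ((Subtype.val : IntermediateField.adjoin k S → K) ⁻¹' S)).val) := by
    intro x y hxy
    apply Subtype.ext
    apply Subtype.ext
    simpa using hxy
  have hle : Algebra.trdeg k (Algebra.adjoin k ((Subtype.val : IntermediateField.adjoin k S → K) ⁻¹' S)) ≤
      Algebra.trdeg k K := trdeg_le_of_injective _ hf
  rw [htrB, htrK] at hle
  have hsn : s ≤ n := by exact_mod_cast hle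
  have hnd : n ≤ d := by
    rw [hnA] at hdim
    exact_mod_cast hdim
  rw [hsB]
  exact_mod_cast hsn.trans hnd

/-- **§2 INPUT 1 (the M-side regular model).**  Local uniformization in dimension `≤ 3` over `k` (F-02 via `.lu3`), an affine model
`A ⊆ O` of `K` of dimension `≤ 3`, and a finite set `S ⊆ O` produce a finitely generated `A' ⊇ k[S]` inside `O ∩ k(S)` whose localisation
at the centre of the restricted valuation ring `O ∩ k(S)` is regular.  For THEOREM T take `S := {a_i^p} ∪ {g₀}` (`a_i` generators of `A`,
`g₀ ∈ A`), so that `k(S) = k·K^p(g₀)` (`adjoin_twist_toSubfield_eq`). -/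
theorem exists_regular_model_subfield (hLU : LocalUniformization3 k) (O : ValuationSubring K) (A : Subalgebra k K)
    (hAO : A.toSubring ≤ O.toSubring) (hfg : A.FG) (hfr : IsFractionRing A K) (hdim : ringKrullDim A ≤ 3)
    (S : Set K) (hSfin : S.Finite) (hSO : ∀ s ∈ S, s ∈ O) :
    ∃ (A' : Subalgebra k (IntermediateField.adjoin k S))
      (h : A'.toSubring ≤ (O.comap (algebraMap (IntermediateField.adjoin k S) K)).toSubring),
      Algebra.adjoin k ((Subtype.val : IntermediateField.adjoin k S → K) ⁻¹' S) ≤ A' ∧ A'.FG ∧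
        IsRegularLocalRing (Localization.AtPrime
          (centreIdeal A' (O.comap (algebraMap (IntermediateField.adjoin k S) K)) h)) := by
  haveI := hfr
  have hk : ∀ c : k, algebraMap k K c ∈ O := fun c => hAO (A.algebraMap_mem c)
  have hBO := adjoin_preimage_le_comap O hk S hSO
  have hBfg : (Algebra.adjoin k ((Subtype.val : IntermediateField.adjoin k S → K) ⁻¹' S)).FG :=
    Subalgebra.fg_def.mpr ⟨_, hSfin.preimage Subtype.val_injective.injOn, rfl⟩
  have hBfr := isFractionRing_adjoin_preimage (k := k) S
  have hBdim := ringKrullDim_adjoin_preimage_le A hfg (d := 3) (by exact_mod_cast hdim) S hSfin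
  exact hLU (IntermediateField.adjoin k S) (O.comap (algebraMap (IntermediateField.adjoin k S) K)) _ hBO hBfg hBfr
    (by exact_mod_cast hBdim)

/-! ## Identification of the twist field `k(t^p ∪ {g₀}) = k·K^p(g₀)` -/

/-- `a ∈ k[t] ⇒ a^p ∈ k[t^p]` in characteristic `p`. -/
theorem pow_mem_adjoin_image_pow (p : ℕ) [Fact p.Prime] [CharP K p] (t : Set K) {a : K} (ha : a ∈ Algebra.adjoin k t) :
    a ^ p ∈ Algebra.adjoin k ((fun x : K => x ^ p) '' t) := by
  induction ha using Algebra.adjoin_induction with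
  | mem x hx => exact Algebra.subset_adjoin ⟨x, hx, rfl⟩
  | algebraMap r =>
      rw [← map_pow]
      exact Subalgebra.algebraMap_mem _ _
  | add x y _ _ hx hy => rw [add_pow_char]; exact add_mem hx hy
  | mul x y _ _ hx hy => rw [mul_pow]; exact mul_mem hx hy

/-- `K^p ⊆ k(S)` as soon as `S ⊇ t^p` for a generating set `t` of an affine model `A` with `Frac A = K`. -/
theorem pow_mem_intermediateField_adjoin (p : ℕ) [Fact p.Prime] [CharP K p] (A : Subalgebra k K) [IsFractionRing A K]
    (t : Set K) (ht : Algebra.adjoin k t = A) (S : Set K) (hS : (fun x : K => x ^ p) '' t ⊆ S) (z : K) :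
    z ^ p ∈ IntermediateField.adjoin k S := by
  obtain ⟨a, b, hb, rfl⟩ := IsFractionRing.div_surjective (A := A) z
  have hle : Algebra.adjoin k ((fun x : K => x ^ p) '' t) ≤ (IntermediateField.adjoin k S).toSubalgebra :=
    (Algebra.adjoin_mono hS).trans (IntermediateField.algebra_adjoin_le_adjoin k S)
  have ha' : ((a : K)) ^ p ∈ IntermediateField.adjoin k S := hle (pow_mem_adjoin_image_pow p t (by rw [ht]; exact a.2))
  have hb' : ((b : K)) ^ p ∈ IntermediateField.adjoin k S := hle (pow_mem_adjoin_image_pow p t (by rw [ht]; exact b.2))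
  rw [show algebraMap A K a / algebraMap A K b = (a : K) / (b : K) from rfl, div_pow]
  exact div_mem ha' hb'

/-- The twist field of THEOREM T′: `k(t^p ∪ {g₀})` has underlying subfield `Subfield.closure (range (algebraMap k K) ∪ range (frobenius K p) ∪ {g₀})`
(`= k·K^p(g₀)`). -/
theorem adjoin_twist_toSubfield_eq (p : ℕ) [Fact p.Prime] [CharP K p] (A : Subalgebra k K) [IsFractionRing A K]
    (t : Set K) (ht : Algebra.adjoin k t = A) (g₀ : K) :
    (IntermediateField.adjoin k ((fun x : K => x ^ p) '' t ∪ {g₀})).toSubfield =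
      Subfield.closure (Set.range (algebraMap k K) ∪ Set.range (frobenius K p) ∪ {g₀}) := by
  rw [IntermediateField.adjoin_toSubfield]
  apply le_antisymm
  · apply Subfield.closure_le.mpr
    rintro x (hx | hx | hx)
    · exact Subfield.subset_closure (Or.inl (Or.inl hx))
    · obtain ⟨y, hy, rfl⟩ := hx
      exact Subfield.subset_closure (Or.inl (Or.inr ⟨y, rfl⟩))
    · exact Subfield.subset_closure (Or.inr hx)
  · apply Subfield.closure_le.mpr
    rintro x ((hx | hx) | hx)
    · exact Subfield.subset_closure (Or.inl hx)
    · obtain ⟨z, rfl⟩ := hx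
      have := pow_mem_intermediateField_adjoin p A t ht ((fun x : K => x ^ p) '' t ∪ {g₀}) Set.subset_union_left z
      rw [frobenius_def]
      exact this
    · exact Subfield.subset_closure (Or.inr (Or.inr hx))

/-- The twist field of THEOREM T: over a PERFECT ground field, `k(t^p ∪ {g₀})` has underlying subfield
`Subfield.closure (range (frobenius K p) ∪ {g₀}) = K^p(g₀)`. -/
theorem adjoin_twist_toSubfield_eq_of_perfectField (p : ℕ) [Fact p.Prime] [CharP K p] [CharP k p] [PerfectField k]
    (A : Subalgebra k K) [IsFractionRing A K] (t : Set K) (ht : Algebra.adjoin k t = A) (g₀ : K) :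
    (IntermediateField.adjoin k ((fun x : K => x ^ p) '' t ∪ {g₀})).toSubfield =
      Subfield.closure (Set.range (frobenius K p) ∪ {g₀}) := by
  rw [adjoin_twist_toSubfield_eq p A t ht g₀]
  apply le_antisymm
  · apply Subfield.closure_le.mpr
    rintro x ((hx | hx) | hx)
    · obtain ⟨c, rfl⟩ := hx
      obtain ⟨c', hc'⟩ := surjective_frobenius k p c
      refine Subfield.subset_closure (Or.inl ⟨algebraMap k K c', ?_⟩)
      rw [frobenius_def, ← map_pow, ← frobenius_def, hc']
    · exact Subfield.subset_closure (Or.inl hx)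
    · exact Subfield.subset_closure (Or.inr hx)
  · exact Subfield.closure_mono (Set.union_subset_union_left _ Set.subset_union_right)

/-! ## (rev 2) The side obligations of F-32 for the M-side model `T := A'_{centre}`: closed centre, excellence, dimension 3 -/

/-- Units of a restricted valuation ring `O ∩ M` are the elements that are units of `O`. -/
theorem isUnit_comap_iff (O : ValuationSubring K) (M : IntermediateField k K) (y : O.comap (algebraMap M K)) :
    IsUnit y ↔ IsUnit (⟨algebraMap M K y, y.2⟩ : O) := by
  rw [isUnit_iff_exists_inv, isUnit_iff_exists_inv]
  constructor
  · rintro ⟨b, hb⟩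
    refine ⟨⟨algebraMap M K b, b.2⟩, Subtype.ext ?_⟩
    have := congrArg (fun z : O.comap (algebraMap M K) => algebraMap M K (z : M)) hb
    simpa using this
  · rintro ⟨b, hb⟩
    have hb' : algebraMap M K (y : M) * (b : K) = 1 := by
      have := congrArg (fun z : O => (z : K)) hb
      simpa using this
    have hy0 : (y : M) ≠ 0 := by
      intro h0
      rw [h0, map_zero, zero_mul] at hb'
      exact zero_ne_one hb'
    have hbinv : (b : K) = algebraMap M K ((y : M)⁻¹) := by
      rw [map_inv₀]
      exact eq_inv_of_mul_eq_one_right hb'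
    have hyinv : (y : M)⁻¹ ∈ O.comap (algebraMap M K) := by
      rw [ValuationSubring.mem_comap, ← hbinv]
      exact b.2
    refine ⟨⟨(y : M)⁻¹, hyinv⟩, Subtype.ext ?_⟩
    change (y : M) * (y : M)⁻¹ = 1
    exact mul_inv_cancel₀ hy0

/-- The maximal ideal of `O ∩ M` is the trace of the maximal ideal of `O`. -/
theorem mem_maximalIdeal_comap_iff (O : ValuationSubring K) (M : IntermediateField k K) (y : O.comap (algebraMap M K)) :
    y ∈ IsLocalRing.maximalIdeal (O.comap (algebraMap M K)) ↔
      (⟨algebraMap M K y, y.2⟩ : O) ∈ IsLocalRing.maximalIdeal O := by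
  rw [IsLocalRing.mem_maximalIdeal, IsLocalRing.mem_maximalIdeal, mem_nonunits_iff, mem_nonunits_iff, isUnit_comap_iff]

/-- **Closed centre on the M-side model.**  If the centre of `O` is closed on every subring `T ⊆ O` containing the affine model
`A = k[t]` of `K` (the customer's hypothesis (hzd)), and `A' ⊆ O ∩ M` is a `k`-subalgebra of a subfield `M ⊆ K` containing a `p`-th power
(`p > 0`) of every generator `a ∈ t`, then the centre of `O ∩ M` on `A'` is a maximal ideal.  (The subring `A'[t] ⊆ O` of `K` contains
`A` and is integral over `A'`; maximality descends along integral extensions.) -/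
theorem centreIdeal_isMaximal_of_pow_generators (O : ValuationSubring K) (A : Subalgebra k K) (hAO : A.toSubring ≤ O.toSubring)
    (t : Set K) (ht : Algebra.adjoin k t = A)
    (hzd : ∀ (T : Subring K) (hT : T ≤ O.toSubring), A.toSubring ≤ T → (subringCentre T O hT).IsMaximal)
    (M : IntermediateField k K) (A' : Subalgebra k M) (h : A'.toSubring ≤ (O.comap (algebraMap M K)).toSubring)
    {p : ℕ} (hp : 0 < p) (htA' : ∀ a ∈ t, ∃ y ∈ A', algebraMap M K y = a ^ p) :
    (centreIdeal A' (O.comap (algebraMap M K)) h).IsMaximal := by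
  have hk : ∀ c : k, algebraMap k K c ∈ O := fun c => hAO (A.algebraMap_mem c)
  -- `f : M → K`, `B := f(A') ⊆ O`
  set f : M →ₐ[k] K := IsScalarTower.toAlgHom k M K with hf_def
  have hf : Function.Injective f := (algebraMap M K).injective
  set B : Subalgebra k K := A'.map f with hB_def
  have hBO : B.toSubring ≤ O.toSubring := by
    intro x hx
    obtain ⟨y, hy, rfl⟩ := Subalgebra.mem_map.mp hx
    exact (ValuationSubring.mem_comap.mp (h hy))
  -- `C := k[B ∪ t] = A'[t] ⊆ O`, contains `A`
  set C : Subalgebra k K := Algebra.adjoin k ((B : Set K) ∪ t) with hC_def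
  have hCO : C.toSubring ≤ O.toSubring := by
    intro x hx
    rw [Subalgebra.mem_toSubring] at hx
    change x ∈ O
    induction hx using Algebra.adjoin_induction with
    | mem x hx =>
        rcases hx with hx | hx
        · exact hBO hx
        · exact hAO (by rw [← ht]; exact Algebra.subset_adjoin hx)
    | algebraMap r => exact hk r
    | add x y _ _ hx hy => exact O.add_mem _ _ hx hy
    | mul x y _ _ hx hy => exact O.mul_mem _ _ hx hy
  have hAC : A ≤ C := by
    rw [← ht]
    exact Algebra.adjoin_mono Set.subset_union_right
  have hBC : B ≤ C := fun x hx => Algebra.subset_adjoin (Or.inl hx)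
  have hmaxC : (subringCentre C.toSubring O hCO).IsMaximal := hzd C.toSubring hCO hAC
  -- `C` is integral over `B`
  letI algBC : Algebra B C := (Subalgebra.inclusion hBC).toRingHom.toAlgebra
  have halgBC : ∀ b : B, (algebraMap B C b : K) = (b : K) := fun b => rfl
  haveI : Algebra.IsIntegral B C := by
    constructor
    intro x
    let g : C →ₐ[B] K :=
      { toRingHom := C.val.toRingHom
        commutes' := fun b => rfl }
    have hg : Function.Injective g := Subtype.val_injective
    rw [← isIntegral_algHom_iff g hg]
    change IsIntegral B (x : K)
    have hCle : C ≤ (integralClosure B K).restrictScalars k := by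
      apply Algebra.adjoin_le
      rintro a (ha | ha)
      · change IsIntegral B a
        exact isIntegral_algebraMap (R := B) (x := ⟨a, ha⟩)
      · change IsIntegral B a
        obtain ⟨y, hy, hya⟩ := htA' a ha
        apply IsIntegral.of_pow hp
        rw [← hya]
        have hmem : algebraMap M K y ∈ B := Subalgebra.mem_map.mpr ⟨y, hy, rfl⟩
        exact isIntegral_algebraMap (R := B) (x := ⟨algebraMap M K y, hmem⟩)
    exact hCle x.2
  have hmaxB' : ((subringCentre C.toSubring O hCO).comap (algebraMap B C)).IsMaximal :=
    Ideal.isMaximal_comap_of_isIntegral_of_isMaximal _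
  have hcentreB : (subringCentre C.toSubring O hCO).comap (algebraMap B C) = centreIdeal B O hBO := by
    ext b
    rw [Ideal.mem_comap, mem_subringCentre_iff]
    change O.valuation (b : K) < 1 ↔ b ∈ centreIdeal B O hBO
    rw [centreIdeal, Ideal.mem_comap, ValuationSubring.valuation_lt_one_iff]
    rfl
  have hmaxB : (centreIdeal B O hBO).IsMaximal := hcentreB ▸ hmaxB'
  -- transport along `A' ≃ B`
  set e : A' ≃ₐ[k] B := A'.equivMapOfInjective f hf with he_def
  have hcentre : centreIdeal A' (O.comap (algebraMap M K)) h = (centreIdeal B O hBO).comap e.toRingEquiv.toRingHom := by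
    ext y
    rw [centreIdeal, Ideal.mem_comap, mem_maximalIdeal_comap_iff, Ideal.mem_comap, centreIdeal, Ideal.mem_comap,
      ValuationSubring.valuation_lt_one_iff, ValuationSubring.valuation_lt_one_iff]
    have hey : ((e y : B) : K) = algebraMap M K (y : M) := by
      rw [he_def, Subalgebra.coe_equivMapOfInjective_apply]
      rfl
    change O.valuation (algebraMap M K (y : M)) < 1 ↔ O.valuation ((e y : B) : K) < 1
    rw [hey]
  rw [hcentre]
  exact Ideal.comap_isMaximal_of_surjective _ e.surjective

/-- **Excellence of the M-side model** `T := A'_{centre}`: a local ring essentially of finite type over a field. -/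
theorem isExcellentRing_localization_centre (M : IntermediateField k K) (O' : ValuationSubring M) (A' : Subalgebra k M)
    (h : A'.toSubring ≤ O'.toSubring) (hfg : A'.FG) :
    IsExcellentRing (Localization.AtPrime (centreIdeal A' O' h)) := by
  haveI : Algebra.FiniteType k A' := A'.fg_iff_finiteType.mp hfg
  exact isExcellentRing_localization_atPrime (isExcellentRing_of_field k) (centreIdeal A' O' h)

/-- `K` is algebraic over a subfield containing all `p`-th powers (`p > 0`). -/
theorem isAlgebraic_of_pow_mem (M : IntermediateField k K) {p : ℕ} (hp : 0 < p) (hM : ∀ z : K, z ^ p ∈ M) :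
    Algebra.IsAlgebraic M K := by
  constructor
  intro z
  apply IsIntegral.isAlgebraic
  apply IsIntegral.of_pow hp
  exact isIntegral_algebraMap (R := M) (x := ⟨z ^ p, hM z⟩)

/-- **Dimension of the M-side affine model**: a finitely generated `A' ⊇ k[S]` inside `M = k(S)`, with `K` algebraic over `M`, has
`dim A' = dim A` (both are `trdeg_k K`). -/
theorem ringKrullDim_eq_of_adjoin_le (A : Subalgebra k K) (hAfg : A.FG) [IsFractionRing A K]
    (S : Set K) (halg : Algebra.IsAlgebraic (IntermediateField.adjoin k S) K)
    (A' : Subalgebra k (IntermediateField.adjoin k S))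
    (hSA' : Algebra.adjoin k ((Subtype.val : IntermediateField.adjoin k S → K) ⁻¹' S) ≤ A') (hA'fg : A'.FG) :
    ringKrullDim A' = ringKrullDim A := by
  haveI : Algebra.FiniteType k A' := A'.fg_iff_finiteType.mp hA'fg
  haveI : Algebra.FiniteType k A := A.fg_iff_finiteType.mp hAfg
  -- `Frac A' = k(S)`
  haveI hfr' : IsFractionRing A' (IntermediateField.adjoin k S) := by
    refine IsFractionRing.of_field _ _ (fun z => ?_)
    obtain ⟨r, hr, s, hs, hz⟩ := IntermediateField.mem_adjoin_iff_div.mp z.2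
    have hrM : r ∈ IntermediateField.adjoin k S := IntermediateField.algebra_adjoin_le_adjoin k S hr
    have hsM : s ∈ IntermediateField.adjoin k S := IntermediateField.algebra_adjoin_le_adjoin k S hs
    refine ⟨⟨⟨r, hrM⟩, hSA' ((mem_adjoin_preimage_iff S _).mpr hr)⟩, ⟨⟨s, hsM⟩, hSA' ((mem_adjoin_preimage_iff S _).mpr hs)⟩, ?_⟩
    apply Subtype.ext
    simpa using hz
  obtain ⟨s, hsA', htrA'⟩ := Literature.RingTheory.KrullDimension.exists_ringKrullDim_eq_and_trdeg_eq k A'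
  obtain ⟨n, hnA, htrA⟩ := Literature.RingTheory.KrullDimension.exists_ringKrullDim_eq_and_trdeg_eq k A
  haveI : FaithfulSMul k A := (faithfulSMul_iff_algebraMap_injective k A).mpr (algebraMap k A).injective
  haveI : FaithfulSMul A K := (faithfulSMul_iff_algebraMap_injective A K).mpr (IsFractionRing.injective A K)
  haveI : Algebra.IsAlgebraic A K := IsLocalization.isAlgebraic K (nonZeroDivisors A)
  haveI : FaithfulSMul k A' := (faithfulSMul_iff_algebraMap_injective k A').mpr (algebraMap k A').injective
  haveI : FaithfulSMul A' (IntermediateField.adjoin k S) :=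
    (faithfulSMul_iff_algebraMap_injective A' _).mpr (IsFractionRing.injective A' (IntermediateField.adjoin k S))
  haveI : Algebra.IsAlgebraic A' (IntermediateField.adjoin k S) :=
    IsLocalization.isAlgebraic (IntermediateField.adjoin k S) (nonZeroDivisors A')
  haveI : FaithfulSMul (IntermediateField.adjoin k S) K :=
    (faithfulSMul_iff_algebraMap_injective _ K).mpr (algebraMap (IntermediateField.adjoin k S) K).injective
  haveI := halg
  have htrK : Algebra.trdeg k K = (n : Cardinal) := by
    rw [← trdeg_add_eq k A (A := K), trdeg_eq_zero (R := A) (A := K), add_zero, htrA]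
  have htrM : Algebra.trdeg k (IntermediateField.adjoin k S) = (n : Cardinal) := by
    rw [← htrK, ← trdeg_add_eq k (IntermediateField.adjoin k S) (A := K),
      trdeg_eq_zero (R := IntermediateField.adjoin k S) (A := K), add_zero]
  have htrA'' : Algebra.trdeg k A' = (n : Cardinal) := by
    rw [← htrM, ← trdeg_add_eq k A' (A := IntermediateField.adjoin k S),
      trdeg_eq_zero (R := A') (A := IntermediateField.adjoin k S), add_zero]
  rw [htrA'] at htrA''
  have hsn : s = n := by exact_mod_cast htrA''
  rw [hsA', hnA, hsn]

/-- **The three side obligations of F-32 for the M-side model, assembled** (memo §2 INPUT 2 / §12): for `S ⊇ t^p` finite, `A = k[t]` an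
affine model of `K` of dimension `3` with (hzd), and `A' ⊇ k[S]` the output of `exists_regular_model_subfield`: the centre of `O ∩ k(S)`
on `A'` is CLOSED, `T := A'_{centre}` is EXCELLENT and `dim T = 3`. -/
theorem model_side_obligations (p : ℕ) [Fact p.Prime] [CharP K p] (O : ValuationSubring K) (A : Subalgebra k K)
    (hAO : A.toSubring ≤ O.toSubring) (hAfg : A.FG) [IsFractionRing A K] (hdim : ringKrullDim A = 3)
    (t : Set K) (ht : Algebra.adjoin k t = A)
    (hzd : ∀ (T : Subring K) (hT : T ≤ O.toSubring), A.toSubring ≤ T → (subringCentre T O hT).IsMaximal)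
    (S : Set K) (htS : (fun x : K => x ^ p) '' t ⊆ S)
    (A' : Subalgebra k (IntermediateField.adjoin k S))
    (h : A'.toSubring ≤ (O.comap (algebraMap (IntermediateField.adjoin k S) K)).toSubring)
    (hSA' : Algebra.adjoin k ((Subtype.val : IntermediateField.adjoin k S → K) ⁻¹' S) ≤ A') (hA'fg : A'.FG) :
    (centreIdeal A' (O.comap (algebraMap (IntermediateField.adjoin k S) K)) h).IsMaximal ∧
      IsExcellentRing (Localization.AtPrime (centreIdeal A' (O.comap (algebraMap (IntermediateField.adjoin k S) K)) h)) ∧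
      ringKrullDim (Localization.AtPrime (centreIdeal A' (O.comap (algebraMap (IntermediateField.adjoin k S) K)) h)) = 3 := by
  have hp : 0 < p := (Fact.out : p.Prime).pos
  have htA' : ∀ a ∈ t, ∃ y ∈ A', algebraMap (IntermediateField.adjoin k S) K y = a ^ p := by
    intro a ha
    have haS : a ^ p ∈ S := htS ⟨a, ha, rfl⟩
    refine ⟨⟨a ^ p, IntermediateField.subset_adjoin k S haS⟩, hSA' (Algebra.subset_adjoin haS), rfl⟩
  have hmax := centreIdeal_isMaximal_of_pow_generators O A hAO t ht hzd (IntermediateField.adjoin k S) A' h hp htA'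
  refine ⟨hmax, isExcellentRing_localization_centre _ _ A' h hA'fg, ?_⟩
  haveI := hmax
  haveI : Algebra.FiniteType k A' := A'.fg_iff_finiteType.mp hA'fg
  have halg : Algebra.IsAlgebraic (IntermediateField.adjoin k S) K :=
    isAlgebraic_of_pow_mem _ hp (pow_mem_intermediateField_adjoin p A t ht S htS)
  rw [ringKrullDim_localization_atPrime_eq_of_isMaximal k (centreIdeal A' _ h),
    ringKrullDim_eq_of_adjoin_le A hAfg S halg A' hSA' hA'fg, hdim]

/-! ## (rev 3) §2 in the PORT's convention: `R := locAtCentre A'.toSubring (O ∩ M) ⊆ ↥M`, `K := ↥M`, `E := K`, `O_E := O`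

THEOREM P's port (`Theorems/RadicialJungCleanModelsCleanLU3Defectless.lean` :156–:195) calls F-32
`exists_localRing_monomial_of_embeddedResolution hEmb (R := S) (K := K) (E := K) Subtype.val_injective hexcS hdim3 O hRO hRm xR …` with
`S = locAtCentre A.toSubring O`.  For the T-slice the call is the same with `R := locAtCentre A'.toSubring (O.comap (algebraMap M K))`
(a subring of `↥M`, `M = k(S) = k·K^p(g₀)`), `K := ↥M`, `E := K`, `O_E := O`, under the composite algebra
`letI : Algebra R K := ((algebraMap M K).comp R.subtype).toAlgebra` (scalar tower by `rfl`).  The theorems below deliver EVERY remaining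
hypothesis of that call from the customer's data: regularity, excellence, dimension `3`, `hRO`, `hRm` (`locAtCentre_port_inputs`), packaged with
INPUT 1 in `exists_twist_model` (one statement: customer hypotheses + F-02·`.lu3` ⟹ the M-side model with all F-32 inputs); plus the two
bookkeeping facts the port meets first: `dim A = 3` from the stub's `dim A ≤ 3 ∧ dim A_centre = 3`, and `g₀` versus `g₀⁻¹` (one of them lies
in `O`; both generate the same field over `K^p`). -/

/-- `centreIdeal A' O' h` (Subalgebra form, `LocalUniformization.lean`) IS `subringCentre A'.toSubring O' h` (Subring form, `LocalBlowup.lean`). -/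
theorem centreIdeal_eq_subringCentre (M : IntermediateField k K) (O' : ValuationSubring M) (A' : Subalgebra k M)
    (h : A'.toSubring ≤ O'.toSubring) : centreIdeal A' O' h = subringCentre A'.toSubring O' h := rfl

/-- The restricted valuation ring `O ∩ M` measures values in `K`: for `y ∈ O ∩ M`, `v_{O∩M}(y) < 1 ↔ v_O(y) < 1`. -/
theorem valuation_comap_lt_one_iff (O : ValuationSubring K) (M : IntermediateField k K) (y : M)
    (hy : y ∈ O.comap (algebraMap M K)) :
    (O.comap (algebraMap M K)).valuation y < 1 ↔ O.valuation (algebraMap M K y) < 1 := by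
  have h1 := ValuationSubring.valuation_lt_one_iff (O.comap (algebraMap M K)) ⟨y, hy⟩
  have h2 := ValuationSubring.valuation_lt_one_iff O ⟨algebraMap M K y, ValuationSubring.mem_comap.mp hy⟩
  have h3 := mem_maximalIdeal_comap_iff O M ⟨y, hy⟩
  rw [← h1, h3, h2]

/-- `dim A = 3` from the stub's `dim A ≤ 3` and `dim (locAtCentre A O) = 3` (a localisation does not raise the dimension). -/
theorem ringKrullDim_eq_three_of_locAtCentre (O : ValuationSubring K) (A : Subalgebra k K) (hAO : A.toSubring ≤ O.toSubring)
    (hle : ringKrullDim A ≤ 3) (h3 : ringKrullDim (locAtCentre A.toSubring O) = 3) : ringKrullDim A = 3 := by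
  haveI := isLocalization_locAtCentre hAO
  refine le_antisymm hle ?_
  rw [← h3]
  exact Literature.RingTheory.KrullDimension.ringKrullDim_le_of_isLocalization
    (subringCentre A.toSubring O hAO).primeCompl (locAtCentre A.toSubring O)

/-- One of `g₀`, `g₀⁻¹` lies in `O`, and both generate the same field over any subfield data: `F(X ∪ {g⁻¹}) = F(X ∪ {g})` as subfields. -/
theorem subfield_closure_union_inv_eq (X : Set K) (g : K) : Subfield.closure (X ∪ {g⁻¹}) = Subfield.closure (X ∪ {g}) := by
  refine le_antisymm (Subfield.closure_le.mpr ?_) (Subfield.closure_le.mpr ?_)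
  · rintro x (hx | hx)
    · exact Subfield.subset_closure (Or.inl hx)
    · rw [Set.mem_singleton_iff.mp hx]
      exact inv_mem (Subfield.subset_closure (Or.inr rfl))
  · rintro x (hx | hx)
    · exact Subfield.subset_closure (Or.inl hx)
    · rw [Set.mem_singleton_iff.mp hx]
      have hg : g⁻¹ ∈ Subfield.closure (X ∪ {g⁻¹}) := Subfield.subset_closure (Or.inr rfl)
      simpa using inv_mem hg

theorem mem_or_inv_mem_valuationSubring (O : ValuationSubring K) (g₀ : K) : ∃ g₁ : K, g₁ ∈ O ∧ (g₁ = g₀ ∨ g₁ = g₀⁻¹) := by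
  rcases O.mem_or_inv_mem g₀ with h | h
  · exact ⟨g₀, h, Or.inl rfl⟩
  · exact ⟨g₀⁻¹, h, Or.inr rfl⟩

/-- **The F-32 inputs for the M-side model in the port's convention.**  For `A' ⊆ O ∩ M` finitely generated over `k` of dimension `3` whose
centre is closed and whose localisation at the centre is regular: `R := locAtCentre A'.toSubring (O ∩ M)` is a REGULAR local ring, EXCELLENT,
of dimension `3`, contained in `O` and DOMINATED by `O` (`r ∈ 𝔪_R ↔ v_O(r) < 1`, values read in `K`). -/
theorem locAtCentre_port_inputs (O : ValuationSubring K) (M : IntermediateField k K) (A' : Subalgebra k M)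
    (h : A'.toSubring ≤ (O.comap (algebraMap M K)).toSubring) (hA'fg : A'.FG)
    (hmax : (centreIdeal A' (O.comap (algebraMap M K)) h).IsMaximal)
    (hreg : IsRegularLocalRing (Localization.AtPrime (centreIdeal A' (O.comap (algebraMap M K)) h)))
    (hdimA' : ringKrullDim A' = 3) :
    ∃ _ : IsRegularLocalRing (locAtCentre A'.toSubring (O.comap (algebraMap M K))),
      IsExcellentRing (locAtCentre A'.toSubring (O.comap (algebraMap M K))) ∧
      ringKrullDim (locAtCentre A'.toSubring (O.comap (algebraMap M K))) = 3 ∧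
      (∀ r : locAtCentre A'.toSubring (O.comap (algebraMap M K)), algebraMap M K (r : M) ∈ O) ∧
      (∀ r : locAtCentre A'.toSubring (O.comap (algebraMap M K)),
        r ∈ IsLocalRing.maximalIdeal (locAtCentre A'.toSubring (O.comap (algebraMap M K))) ↔
          O.valuation (algebraMap M K (r : M)) < 1) := by
  have hreg' : IsRegularLocalRing (locAtCentre A'.toSubring (O.comap (algebraMap M K))) :=
    (isRegularLocalRing_locAtCentre_iff h).mpr hreg
  haveI := hreg'
  haveI := isLocalization_locAtCentre h
  haveI : Algebra.FiniteType k A' := A'.fg_iff_finiteType.mp hA'fg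
  have hexcA' : IsExcellentRing A' := isExcellentRing_of_finiteType_field k A'
  have hexc : IsExcellentRing (locAtCentre A'.toSubring (O.comap (algebraMap M K))) :=
    IsExcellentRing.of_isLocalization (A := A'.toSubring) (B := locAtCentre A'.toSubring (O.comap (algebraMap M K)))
      (subringCentre A'.toSubring (O.comap (algebraMap M K)) h).primeCompl hexcA'
  have hdim : ringKrullDim (locAtCentre A'.toSubring (O.comap (algebraMap M K))) = 3 := by
    rw [← ringKrullDim_eq_of_ringEquiv (locAtCentreEquiv h).toRingEquiv]
    haveI := hmax
    change ringKrullDim (Localization.AtPrime (centreIdeal A' (O.comap (algebraMap M K)) h)) = 3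
    rw [ringKrullDim_localization_atPrime_eq_of_isMaximal k (centreIdeal A' (O.comap (algebraMap M K)) h), hdimA']
  refine ⟨hreg', hexc, hdim, fun r => ValuationSubring.mem_comap.mp (locAtCentre_le h r.2), fun r => ?_⟩
  rw [mem_maximalIdeal_locAtCentre_iff h r]
  exact valuation_comap_lt_one_iff O M (r : M) (locAtCentre_le h r.2)

/-- **§2 of THEOREM T, assembled in the port's convention.**  Customer data — an affine model `A = k[t] ⊆ O` of `K` (`t` finite,
`Frac A = K`, `dim A = 3`; use `ringKrullDim_eq_three_of_locAtCentre`), the closed-centre hypothesis (hzd), an element `g₁ ∈ O` (`g₀` or `g₀⁻¹`,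
`mem_or_inv_mem_valuationSubring`) — together with F-02 via `.lu3` (`hLU : LocalUniformization3 k`) give, on the twist field `M := k(t^p ∪ {g₁})`
(`= k·K^p(g₀)` as a subfield: `adjoin_twist_toSubfield_eq` + `subfield_closure_union_inv_eq`; `= K^p(g₀)` for perfect `k`), a finitely generated
`A' ⊇ k[t^p, g₁]` inside `O ∩ M` such that `R := locAtCentre A'.toSubring (O ∩ M)` satisfies every hypothesis of F-32
`exists_localRing_monomial_of_embeddedResolution` with `K := ↥M`, `E := K`, `O_E := O`: regular local, excellent, `dim R = 3`, `R ⊆ O`, dominated. -/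
theorem exists_twist_model (p : ℕ) [Fact p.Prime] [CharP K p] (hLU : LocalUniformization3 k) (O : ValuationSubring K)
    (A : Subalgebra k K) (hAO : A.toSubring ≤ O.toSubring) (hAfg : A.FG) [IsFractionRing A K] (hdimA : ringKrullDim A = 3)
    (t : Finset K) (ht : Algebra.adjoin k (t : Set K) = A)
    (hzd : ∀ (T : Subring K) (hT : T ≤ O.toSubring), A.toSubring ≤ T → (subringCentre T O hT).IsMaximal)
    (g₁ : K) (hg₁ : g₁ ∈ O) (S : Set K) (hS : S = (fun x : K => x ^ p) '' (t : Set K) ∪ {g₁}) :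
    ∃ (A' : Subalgebra k (IntermediateField.adjoin k S)),
      A'.toSubring ≤ (O.comap (algebraMap (IntermediateField.adjoin k S) K)).toSubring ∧
      Algebra.adjoin k ((Subtype.val : IntermediateField.adjoin k S → K) ⁻¹' S) ≤ A' ∧ A'.FG ∧
      ∃ _ : IsRegularLocalRing (locAtCentre A'.toSubring (O.comap (algebraMap (IntermediateField.adjoin k S) K))),
        IsExcellentRing (locAtCentre A'.toSubring (O.comap (algebraMap (IntermediateField.adjoin k S) K))) ∧
        ringKrullDim (locAtCentre A'.toSubring (O.comap (algebraMap (IntermediateField.adjoin k S) K))) = 3 ∧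
        (∀ r : locAtCentre A'.toSubring (O.comap (algebraMap (IntermediateField.adjoin k S) K)),
          algebraMap (IntermediateField.adjoin k S) K (r : IntermediateField.adjoin k S) ∈ O) ∧
        (∀ r : locAtCentre A'.toSubring (O.comap (algebraMap (IntermediateField.adjoin k S) K)),
          r ∈ IsLocalRing.maximalIdeal _ ↔ O.valuation (algebraMap (IntermediateField.adjoin k S) K (r : IntermediateField.adjoin k S)) < 1) := by
  have hSfin : S.Finite := by
    rw [hS]
    exact ((t.finite_toSet).image _).union (Set.finite_singleton _)
  have hSO : ∀ s ∈ S, s ∈ O := by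
    intro s hs
    rw [hS] at hs
    rcases hs with ⟨a, ha, rfl⟩ | hs
    · have haA : a ∈ A := by rw [← ht]; exact Algebra.subset_adjoin ha
      exact (pow_mem (hAO haA) p : a ^ p ∈ O.toSubring)
    · rw [Set.mem_singleton_iff.mp hs]; exact hg₁
  have htS : (fun x : K => x ^ p) '' (t : Set K) ⊆ S := by rw [hS]; exact Set.subset_union_left
  obtain ⟨A', h, hSA', hA'fg, hreg⟩ := exists_regular_model_subfield hLU O A hAO hAfg inferInstance hdimA.le S hSfin hSO
  obtain ⟨hmax, -, -⟩ := model_side_obligations p O A hAO hAfg hdimA (t : Set K) ht hzd S htS A' h hSA' hA'fg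
  have hp : 0 < p := (Fact.out : p.Prime).pos
  have halg : Algebra.IsAlgebraic (IntermediateField.adjoin k S) K :=
    isAlgebraic_of_pow_mem _ hp (pow_mem_intermediateField_adjoin p A (t : Set K) ht S htS)
  have hdimA' : ringKrullDim A' = 3 := by rw [ringKrullDim_eq_of_adjoin_le A hAfg S halg A' hSA' hA'fg, hdimA]
  exact ⟨A', h, hSA', hA'fg, locAtCentre_port_inputs O _ A' h hA'fg hmax hreg hdimA'⟩

/-! ## (rev 3) THE F-32 CALL ITSELF on the M-side model (instance plumbing de-risked)

Under the composite algebra `R → ↥M → K` (supplied by the port as `letI : Algebra R K := ((algebraMap M K).comp R.subtype).toAlgebra` with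
`IsScalarTower R M K` by `IsScalarTower.of_algebraMap_eq fun _ => rfl`; taken here as instance hypotheses, so the statement stays def-free)
the F-32 entry `exists_localRing_monomial_of_embeddedResolution` applies VERBATIM with `K := ↥M`, `E := K`, `O_E := O` to any
`0 ≠ x_R ∈ 𝔪_R` of `R := locAtCentre A'.toSubring (O ∩ M)`: this is §2 INPUT 2 of THEOREM T (the element to monomialise, `x^p y^p ∏ τσ`,
comes from §1 and lies in `M`).  Universe `0` throughout (`Scheme.{0}` in `hEmb`, as in THEOREM P's port). -/

section F32Call

open AlgebraicGeometry CategoryTheory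

/-- **F-32 on the twist field.**  [cite: CossartJannsenSaito2020, Cor. 1.5, p. 7] (hypothesis `hEmb`, F-78 shape) -/
theorem monomialise_on_twist_model
    (hEmb : ∀ (Z : Scheme.{0}) [IsIntegral Z] [IsNoetherian Z], Scheme.IsRegular Z →
      Scheme.IsExcellent Z → ∀ (X : Set Z), IsClosed X → X ≠ Set.univ → topologicalKrullDim X ≤ 2 →
        ∃ (Z' : Scheme.{0}) (π : Z' ⟶ Z), IsProper π ∧ Function.Surjective π.base ∧
          (∃ U : Z.Opens, (U : Set Z) = Xᶜ ∧ IsIso (π ∣_ U)) ∧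
          IsStrictNormalCrossingsDivisor Z' (π.base ⁻¹' X))
    (O : ValuationSubring K) (M : IntermediateField k K) (A' : Subalgebra k M)
    (h : A'.toSubring ≤ (O.comap (algebraMap M K)).toSubring) (hA'fg : A'.FG)
    (hmax : (centreIdeal A' (O.comap (algebraMap M K)) h).IsMaximal)
    (hreg : IsRegularLocalRing (Localization.AtPrime (centreIdeal A' (O.comap (algebraMap M K)) h)))
    (hdimA' : ringKrullDim A' = 3)
    [Algebra (locAtCentre A'.toSubring (O.comap (algebraMap M K))) K]
    [IsScalarTower (locAtCentre A'.toSubring (O.comap (algebraMap M K))) M K]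
    (xR : locAtCentre A'.toSubring (O.comap (algebraMap M K))) (hxR0 : xR ≠ 0)
    (hxRm : O.valuation (algebraMap M K (xR : M)) < 1) :
    ∃ uu : Finset K, ((uu : Set K) ⊆ Set.range (algebraMap M K)) ∧
      (∀ y ∈ Algebra.adjoin (locAtCentre A'.toSubring (O.comap (algebraMap M K))) (uu : Set K), y ∈ O) ∧
      ∃ (R' : Type) (_ : CommRing R') (_ : IsRegularLocalRing R') (_ : Algebra R' K),
        Function.Injective (algebraMap R' K) ∧ (∀ r : R', algebraMap R' K r ∈ O) ∧
        (∀ r : R', r ∈ IsLocalRing.maximalIdeal R' ↔ O.valuation (algebraMap R' K r) < 1) ∧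
        (∀ y ∈ Algebra.adjoin (locAtCentre A'.toSubring (O.comap (algebraMap M K))) (uu : Set K),
          y ∈ Set.range (algebraMap R' K)) ∧
        (∀ r : R', ∃ τ σ : K, τ ∈ Algebra.adjoin (locAtCentre A'.toSubring (O.comap (algebraMap M K))) (uu : Set K) ∧
          σ ∈ Algebra.adjoin (locAtCentre A'.toSubring (O.comap (algebraMap M K))) (uu : Set K) ∧
          O.valuation σ = 1 ∧ algebraMap R' K r * σ = τ) ∧
        ∃ (d : ℕ) (z : Fin d → R') (α : Fin d → ℕ) (u : R'), IsUnit u ∧ ringKrullDim R' = d ∧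
          Ideal.span (Set.range z) = IsLocalRing.maximalIdeal R' ∧
          algebraMap (locAtCentre A'.toSubring (O.comap (algebraMap M K))) K xR = algebraMap R' K (u * ∏ i, z i ^ α i) := by
  obtain ⟨hreg', hexc, hdim, hRO, hRm⟩ := locAtCentre_port_inputs O M A' h hA'fg hmax hreg hdimA'
  haveI := hreg'
  have halg : ∀ r : locAtCentre A'.toSubring (O.comap (algebraMap M K)),
      algebraMap (locAtCentre A'.toSubring (O.comap (algebraMap M K))) K r = algebraMap M K (r : M) := fun r =>
    IsScalarTower.algebraMap_apply (locAtCentre A'.toSubring (O.comap (algebraMap M K))) M K r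
  have hRO' : ∀ r : locAtCentre A'.toSubring (O.comap (algebraMap M K)),
      algebraMap (locAtCentre A'.toSubring (O.comap (algebraMap M K))) K r ∈ O := fun r => by rw [halg]; exact hRO r
  have hRm' : ∀ r : locAtCentre A'.toSubring (O.comap (algebraMap M K)),
      r ∈ IsLocalRing.maximalIdeal _ ↔ O.valuation (algebraMap (locAtCentre A'.toSubring (O.comap (algebraMap M K))) K r) < 1 :=
    fun r => by rw [halg]; exact hRm r
  have hxRm' : xR ∈ IsLocalRing.maximalIdeal _ := (hRm xR).mpr hxRm
  exact exists_localRing_monomial_of_embeddedResolution hEmb (R := locAtCentre A'.toSubring (O.comap (algebraMap M K)))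
    (K := M) (E := K) Subtype.val_injective hexc hdim O hRO' hRm' xR hxR0 hxRm'

end F32Call

end Summit.ResolutionOfSingularities.ResolutionOfSingularities.Cruxes.DescentPerfectToAll.CpSibling.TwistModel
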